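import Mathlib
import HarnessLib
import Literature.Analysis.FluidPDE.ParabolicComparison
import Literature.Analysis.FluidPDE.VectorCalculus

/-!
# Item `LrcModEntire` (stmt-NavierStokesRegularity-20428), CLASS road to `stub_twistingTHGerm` — the LINK conjunct of the similarity-(OSC) hypothesis
# object: on a proportional-shear plane of a poloidal slice, «oscillation of the Clebsch weight = 0 ⇒ vorticity = 0 on the plane»

Cell ns-regularity-ideate, LEAD ns-poloidal-K2-p3 g13 (`--supports stmt-NavierStokesRegularity-20428`; (h2-c) of the division of labour with ns-k2-port-2 g3;
consumed by `…TwistingTHOscRoad.eq_zero_of_similarityOsc`, whose hypothesis object ends with exactly this link).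

On a plane `{y₂ = c}` with `(∂₂V)_b = μ(∂_bV)₂` (`b = 0,1`) and `(curl V)₂ = 0` (poloidality) the vorticity is
`curl V = ((1−μ)∂₁V₂, −(1−μ)∂₀V₂, 0)` (`curl_eq_on_planeShear`), so it vanishes on the plane as soon as EITHER `μ = 1` OR `V₂` is constant on the plane
— i.e. as soon as the plane oscillation of the weight `W = (1−μ)V₂` vanishes (`curl_eq_zero_on_plane_of_slope_one`, `curl_eq_zero_on_plane_of_const`,
`curl_eq_zero_on_plane_of_weightOsc_zero`).  Pure calculus; no Navier–Stokes input.

WHAT THIS IS NOT: not a claim about Navier–Stokes regularity and not the stub (bears_on LADDER-NS N0, item 20428 / crux 19708; both OPEN).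
-/

noncomputable section

-- the summit and its single sub-problem share the name (CONVENTIONS §1), as in every Theorems file
set_option linter.dupNamespace false

namespace Summit.NavierStokesRegularity.NavierStokesRegularity.Theorems.PoloidalWindowDoorLrcModEntireTwistingTHPlaneOscillationLink

open Set Filter Topology
open scoped RealInnerProductSpace
open Literature.Analysis.FluidPDE

variable {V : EuclideanSpace ℝ (Fin 3) → EuclideanSpace ℝ (Fin 3)} {μ c : ℝ}

/-- The class's poloidality hypothesis `⟪curl V y, e₂⟫ = 0` in component form. -/
theorem curl_apply_two_eq_zero_of_inner {y : EuclideanSpace ℝ (Fin 3)}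
    (h : @inner ℝ _ _ (curl V y) (EuclideanSpace.single 2 (1 : ℝ)) = 0) : curl V y 2 = 0 := by
  simpa [EuclideanSpace.inner_single_right] using h

/-- **The vorticity on a proportional-shear plane of a poloidal field**: `curl V = ((1−μ)∂₁V₂, −(1−μ)∂₀V₂, 0)` at every point of the plane. -/
theorem curl_eq_on_planeShear
    (hslope : ∀ y : EuclideanSpace ℝ (Fin 3), y 2 = c → ∀ b : Fin 3, b ≠ 2 →
      fderiv ℝ V y (EuclideanSpace.single 2 1) b = μ * fderiv ℝ V y (EuclideanSpace.single b 1) 2)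
    (hpol : ∀ y : EuclideanSpace ℝ (Fin 3), y 2 = c → curl V y 2 = 0)
    {y : EuclideanSpace ℝ (Fin 3)} (hy : y 2 = c) :
    curl V y 0 = (1 - μ) * fderiv ℝ V y (EuclideanSpace.single 1 1) 2 ∧
    curl V y 1 = -(1 - μ) * fderiv ℝ V y (EuclideanSpace.single 0 1) 2 ∧ curl V y 2 = 0 := by
  have h0 := hslope y hy 0 (by decide)
  have h1 := hslope y hy 1 (by decide)
  refine ⟨?_, ?_, hpol y hy⟩
  · have e : curl V y 0 = fderiv ℝ V y (EuclideanSpace.single 1 1) 2 - fderiv ℝ V y (EuclideanSpace.single 2 1) 1 := by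
      simp [curl]
    rw [e, h1]; ring
  · have e : curl V y 1 = fderiv ℝ V y (EuclideanSpace.single 2 1) 0 - fderiv ℝ V y (EuclideanSpace.single 0 1) 2 := by
      simp [curl]
    rw [e, h0]; ring

/-- **`μ = 1` ⇒ the vorticity vanishes on the plane.** -/
theorem curl_eq_zero_on_plane_of_slope_one
    (hslope : ∀ y : EuclideanSpace ℝ (Fin 3), y 2 = c → ∀ b : Fin 3, b ≠ 2 →
      fderiv ℝ V y (EuclideanSpace.single 2 1) b = μ * fderiv ℝ V y (EuclideanSpace.single b 1) 2)
    (hpol : ∀ y : EuclideanSpace ℝ (Fin 3), y 2 = c → curl V y 2 = 0) (hμ : μ = 1)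
    {y : EuclideanSpace ℝ (Fin 3)} (hy : y 2 = c) : curl V y = 0 := by
  obtain ⟨e0, e1, e2⟩ := curl_eq_on_planeShear hslope hpol hy
  ext i
  fin_cases i
  · simp [e0, hμ]
  · simp [e1, hμ]
  · simp [e2]

/-- A horizontal partial derivative of the height component `V₂` vanishes at a point of a plane on which `V₂` is constant. -/
theorem fderiv_horiz_two_eq_zero_of_const (hV : Differentiable ℝ V)
    (hconst : ∀ y y' : EuclideanSpace ℝ (Fin 3), y 2 = c → y' 2 = c → V y 2 = V y' 2)
    {y : EuclideanSpace ℝ (Fin 3)} (hy : y 2 = c) {b : Fin 3} (hb : b ≠ 2) :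
    fderiv ℝ V y (EuclideanSpace.single b 1) 2 = 0 := by
  set e : EuclideanSpace ℝ (Fin 3) := EuclideanSpace.single b (1 : ℝ) with he
  have he2 : e 2 = 0 := by
    rw [he]; simp [hb.symm]
  have hV2 : Differentiable ℝ fun x : EuclideanSpace ℝ (Fin 3) => V x 2 :=
    fun x => (EuclideanSpace.proj (𝕜 := ℝ) (2 : Fin 3)).differentiableAt.comp x (hV x)
  have hfd2 : fderiv ℝ (fun x => V x 2) y e = fderiv ℝ V y e 2 := by
    have h := (EuclideanSpace.proj (𝕜 := ℝ) (2 : Fin 3)).hasFDerivAt.comp y (hV y).hasFDerivAt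
    rw [show (fun x => V x 2) = (EuclideanSpace.proj (𝕜 := ℝ) (2 : Fin 3)) ∘ V from rfl, h.fderiv]
    simp
  -- the line `σ ↦ y + σ e` stays in the plane, so `σ ↦ V₂(y + σ e)` is constant
  have hline := hasDerivAt_comp_line hV2 y e 0
  have hconstfun : (fun σ : ℝ => V (y + σ • e) 2) = fun _ => V y 2 := by
    funext σ
    exact hconst _ _ (by simp [he2, hy]) hy
  have hzero : HasDerivAt (fun σ : ℝ => V (y + σ • e) 2) 0 0 := by
    rw [hconstfun]; exact hasDerivAt_const 0 _
  have huniq := hline.unique hzero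
  rw [zero_smul, add_zero, hfd2] at huniq
  exact huniq

/-- **`V₂` constant on the plane ⇒ the vorticity vanishes on the plane.** -/
theorem curl_eq_zero_on_plane_of_const (hV : Differentiable ℝ V)
    (hslope : ∀ y : EuclideanSpace ℝ (Fin 3), y 2 = c → ∀ b : Fin 3, b ≠ 2 →
      fderiv ℝ V y (EuclideanSpace.single 2 1) b = μ * fderiv ℝ V y (EuclideanSpace.single b 1) 2)
    (hpol : ∀ y : EuclideanSpace ℝ (Fin 3), y 2 = c → curl V y 2 = 0)
    (hconst : ∀ y y' : EuclideanSpace ℝ (Fin 3), y 2 = c → y' 2 = c → V y 2 = V y' 2)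
    {y : EuclideanSpace ℝ (Fin 3)} (hy : y 2 = c) : curl V y = 0 := by
  obtain ⟨e0, e1, e2⟩ := curl_eq_on_planeShear hslope hpol hy
  have d0 := fderiv_horiz_two_eq_zero_of_const hV hconst hy (b := 0) (by decide)
  have d1 := fderiv_horiz_two_eq_zero_of_const hV hconst hy (b := 1) (by decide)
  ext i
  fin_cases i
  · simp [e0, d1]
  · simp [e1, d0]
  · simp [e2]

/-- **THE LINK.**  On a proportional-shear plane `{y₂ = c}` (slope `μ`) of a poloidal differentiable field, if the plane oscillation of the weight
`W = (1−μ)V₂` vanishes — `(1−μ)(V₂(y) − V₂(y′)) = 0` for all `y, y′` on the plane — then `curl V = 0` on the plane.  (Either `μ = 1`, or `V₂` is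
constant on the plane.)  This is the last conjunct of the hypothesis object of `…TwistingTHOscRoad.eq_zero_of_similarityOsc` for the genuine
`Q = √(−t)·osc_plane W`. -/
theorem curl_eq_zero_on_plane_of_weightOsc_zero (hV : Differentiable ℝ V)
    (hslope : ∀ y : EuclideanSpace ℝ (Fin 3), y 2 = c → ∀ b : Fin 3, b ≠ 2 →
      fderiv ℝ V y (EuclideanSpace.single 2 1) b = μ * fderiv ℝ V y (EuclideanSpace.single b 1) 2)
    (hpol : ∀ y : EuclideanSpace ℝ (Fin 3), y 2 = c → curl V y 2 = 0)
    (hosc : ∀ y y' : EuclideanSpace ℝ (Fin 3), y 2 = c → y' 2 = c → (1 - μ) * (V y 2 - V y' 2) = 0)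
    {y : EuclideanSpace ℝ (Fin 3)} (hy : y 2 = c) : curl V y = 0 := by
  by_cases hμ : μ = 1
  · exact curl_eq_zero_on_plane_of_slope_one hslope hpol hμ hy
  · have hne : 1 - μ ≠ 0 := sub_ne_zero.2 (Ne.symm hμ)
    refine curl_eq_zero_on_plane_of_const hV hslope hpol (fun y y' hyc hy'c => ?_) hy
    have h := hosc y y' hyc hy'c
    rcases mul_eq_zero.1 h with h1 | h1
    · exact absurd h1 hne
    · linarith

end Summit.NavierStokesRegularity.NavierStokesRegularity.Theorems.PoloidalWindowDoorLrcModEntireTwistingTHPlaneOscillationLink
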